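import Literature.MathematicalPhysics.QuantumLattice.XXZIsingGroundStateSpontaneousOrder
import HarnessLib

/-!
# KT93 (7.10) in ONE finite volume for the XXZ model: a certified ground-state long-range-order number on a torus
# gives an explicit floor on the sourced staggered magnetisation of EVERY ground state of `H - B·O` on that torus

T. Koma, H. Tasaki, *Symmetry breaking in Heisenberg antiferromagnets*, Commun. Math. Phys. **158** (1993) 191–214
(`KomaTasaki1993`), §7, proof of Theorem 7.1 (Kaplan–Horsch–von der Linden), p. 210, eq. (7.10):

> `N⁻¹ (Φ_Λ(B), O_Λ Φ_Λ(B)) ≥ σ_Λ - O(N⁻¹)/(B N)`,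

with `σ_Λ = N⁻¹√(Φ_Λ, O_Λ²Φ_Λ)` (7.8) and the `O(N⁻¹)` the Horsch–von der Linden energy of the trial state (7.9).  The
tree's abstract form with the explicit constant is `KomaTasaki.kaplanHorschVonDerLinden_order_density`
(`KaplanHorschVonDerLindenFieldBound.lean`): `N⁻¹ Re⟨Φ_B, OΦ_B⟩ ≥ μō - r²h̄/(μ²BN²)`.

This file is the FINITE-VOLUME, EXPLICIT-CONSTANT instance for the XXZ model `H = JΣ_{⟨x,y⟩}(SˣSˣ+SʸSʸ+ΔSᶻSᶻ)`
(spin `n/2`, ANY `J`, `Δ`, any torus `(ℤ/Lℤ)^d`, any sign exponent `σ`, any component `α`): the INPUT is one number —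
a lower bound `s²N² ≤ Re ω_GS((O^α_Λ)²)` for the tracial ground state on that torus, `O^α_Λ = Σ_x(-1)^{σx}S^α_x` —
and the OUTPUT is the floor, for every field `B > 0` and EVERY normalised ground state `Φ_B` of `H - B·O^α_Λ`,

  `N⁻¹ Re⟨Φ_B, O^α_Λ Φ_B⟩ ≥ s - (2d+2)² h̄ / (μ² B N²)`,  `μ = s/ō`, `ō = n/2 + 1`, `h̄ = XXZKT.hbar d n J Δ`

(`xxz_ground_sourcedOrder_ge_finiteVolume`; tracial form `…_groundStateFunctional`), and the finite-volume `U(1)` (`√2`, Theorem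
7.3 (7.24)–(7.26)) and `SU(2)` (`√3`, Corollary 7.2 / Theorem 6.1) tower forms with explicit size condition and error
terms (`xxz_ground_sourcedOrder_ge_finiteVolume_u1`, `heisenbergAF_ground_sourcedOrder_ge_finiteVolume_su2`).  No limit is taken; the
symmetric long-range-ordered ground state `Φ_Λ` of KT93 i') is produced from the tracial datum by
`Matrix.exists_groundState_eigenvector_of_symmetry_re_ge` with the half turn that flips the component `α`
(`exists_halfTurn_flip`: about the `z`-axis for `α ∈ {x, y}`, about the `y`-axis for `α = z`), its odd moments vanish
(`dotProduct_mulVec_eq_zero_of_anticommute`), and `μ ≤ 1` is derived (`mu_le_one_of_sq_le`).  Sequences of tori and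
`liminf`s are in `XXZGroundStateSpontaneousOrder.lean` / `XXZIsingGroundStateSpontaneousOrder.lean`.

No definitions, no named facts, no sorry.

## References
* [KomaTasaki1993] T. Koma, H. Tasaki, Commun. Math. Phys. **158** (1993) 191–214, §7 Theorem 7.1, (7.4)–(7.10), i').
* [KaplanHorschVonDerLinden1989] T. A. Kaplan, P. Horsch, W. von der Linden, J. Phys. Soc. Jpn. **58** (1989) 3894–3898.
* [Tasaki2019Tower] H. Tasaki, J. Stat. Phys. **174** (2019) 735–761, Theorem 2.1 and the continuity remark after it.
* [KomaTasaki1994] T. Koma, H. Tasaki, J. Stat. Phys. **76** (1994) 745–803, Theorem 2.2 (2.9) (`c₀ = 2r²hμ⁻²`).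
-/

noncomputable section

open Matrix Finset Filter Topology WithLp
open scoped ComplexOrder Matrix.Norms.L2Operator InnerProductSpace ComplexConjugate
open Literature.MathematicalPhysics.QuantumLattice Literature.MathematicalPhysics.QuantumLattice.SpinOperators
  Literature.MathematicalPhysics.QuantumLattice.KomaTasaki Literature.Probability.LatticeModels

namespace Literature.MathematicalPhysics.QuantumLattice

namespace XXZKT

/-! ### The half turns flipping each spin component -/

section HalfTurns

variable {Λ : Type*} [Fintype Λ] [DecidableEq Λ] (n : ℕ)

/-- `Uᴴ U = 1` for the half turn about the `z`-axis. [cite: KomaTasaki1993, §2 (U_Λ unitary)] -/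
theorem halfTurn_conjTranspose_mul : (halfTurn (Λ := Λ) n)ᴴ * halfTurn n = 1 := by
  rw [halfTurn, conjTranspose_mul, Matrix.mul_assoc, ← Matrix.mul_assoc (quarterTurn n)ᴴ (quarterTurn n),
    quarterTurn_conjTranspose_mul, Matrix.one_mul, quarterTurn_conjTranspose_mul]

/-- **KT93 (2.3), (2.5) for every component**: for each `α` there is a unitary `U` (a global half turn: about the
`z`-axis for `α ∈ {x, y}`, about the `y`-axis for `α = z`) with `U H_XXZ Uᴴ = H_XXZ` (every `J, Δ`) and
`U O^α Uᴴ = -O^α`, `O^α = Σ_x(-1)^{σx}S^α_x`. [cite: KomaTasaki1993, §2 (2.3), (2.5)] [cite: Tasaki2020, §2.2 eq. (2.2.12)] -/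
theorem exists_halfTurn_flip (G : SimpleGraph Λ) [DecidableRel G.Adj] (J Δ : ℝ) (σ : Λ → ℕ) (α : Fin 3) :
    ∃ U : Op Λ (n + 1), Uᴴ * U = 1 ∧ U * xxzHamiltonian n G J Δ * Uᴴ = xxzHamiltonian n G J Δ ∧
      U * stagSpin n σ α * Uᴴ = -stagSpin n σ α := by
  fin_cases α
  · exact ⟨halfTurn n, halfTurn_conjTranspose_mul n, halfTurn_conj_xxzHamiltonian n G J Δ,
      halfTurn_conj_stagSpin_zero n σ⟩
  · exact ⟨halfTurn n, halfTurn_conjTranspose_mul n, halfTurn_conj_xxzHamiltonian n G J Δ,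
      halfTurn_conj_stagSpin_one n σ⟩
  · exact ⟨halfTurnY n, halfTurnY_conjTranspose_mul n, halfTurnY_conj_xxzHamiltonian n G J Δ,
      halfTurnY_conj_stagSpin_two n σ⟩

end HalfTurns

/-! ### The finite-volume floor -/

section FiniteVolume

variable {d : ℕ}

/-- **KT93 (7.10) / KAPLAN–HORSCH–VON DER LINDEN IN ONE FINITE VOLUME, FOR THE XXZ MODEL — explicit constants, no
limit.**  On the torus `Λ = (ℤ/Lℤ)^d` (`N = L^d` sites), for the spin-`n/2` XXZ Hamiltonian
`H = xxzHamiltonian n (torusGraph d L) J Δ` (any `J`, `Δ`), a sign exponent `σ` and a component `α`, put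
`O = Σ_x(-1)^{σx}S^α_x`.  INPUT: a number `s > 0` with `s² N² ≤ Re ω_GS(O²)` (a lower bound on the long-range order of
the tracial ground state of `H` on THIS torus).  OUTPUT: for every field `B > 0` and EVERY normalised ground state `Φ_B`
of `H - B·O`,
**`N⁻¹ Re⟨Φ_B, OΦ_B⟩ ≥ s - (2d+2)² h̄ / (μ² B N²)`**, `μ = s/ō`, `ō = sNorm n = n/2+1`, `h̄ = hbar d n J Δ`
(`= (|J|/2)·2d·(2+|Δ|)ō²`).  Proof: a half turn `U` fixing `H` and flipping `O` (`exists_halfTurn_flip`); a ground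
eigenstate `Φ` of `H` which is a `U`-eigenvector with `Re Φ†O²Φ ≥ Re ω_GS(O²)`
(`Matrix.exists_groundState_eigenvector_of_symmetry_re_ge`), whose odd moments vanish
(`dotProduct_mulVec_eq_zero_of_anticommute`) — KT93 i'); `μ ≤ 1` (`mu_le_one_of_sq_le`); then
`KomaTasaki.kaplanHorschVonDerLinden_order_density` with `r = 2d+2`.
[cite: KomaTasaki1993, Theorem 7.1, (7.4)–(7.10), i')] [cite: KaplanHorschVonDerLinden1989, main theorem]
[cite: Tasaki2019Tower, Theorem 2.1] -/
theorem xxz_ground_sourcedOrder_ge_finiteVolume (L : ℕ) [NeZero L] (n : ℕ) (J Δ : ℝ) (σ : TorusSite d L → ℕ)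
    (α : Fin 3) {s : ℝ} (hs : 0 < s)
    (hlro : s ^ 2 * (Fintype.card (TorusSite d L) : ℝ) ^ 2 ≤
      ((xxzHamiltonian n (torusGraph d L) J Δ).groundStateFunctional (stagSpin n σ α * stagSpin n σ α)).re)
    {B : ℝ} (hB : 0 < B) {ΦB : TensorIndex (TorusSite d L) (n + 1) → ℂ} (hΦB : star ΦB ⬝ᵥ ΦB = 1)
    (hHB : (xxzHamiltonian n (torusGraph d L) J Δ - (B : ℂ) • stagSpin n σ α) *ᵥ ΦB =
      ((xxzHamiltonian n (torusGraph d L) J Δ - (B : ℂ) • stagSpin n σ α).groundEnergy : ℂ) • ΦB) :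
    s - ((2 * d + 2 : ℕ) : ℝ) ^ 2 * hbar d n J Δ / (s / sNorm n) ^ 2 /
        (B * (Fintype.card (TorusSite d L) : ℝ) ^ 2) ≤
      (star ΦB ⬝ᵥ (stagSpin n σ α *ᵥ ΦB)).re / (Fintype.card (TorusSite d L) : ℝ) := by
  set μ : ℝ := s / sNorm n with hμ_def
  have hsN : 0 < sNorm n := lt_of_lt_of_le zero_lt_one (one_le_sNorm n)
  have hμ : 0 < μ := div_pos hs hsN
  have hμs : μ * sNorm n = s := by rw [hμ_def, div_mul_cancel₀ _ hsN.ne']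
  -- the objects
  set H₀ := xxzHamiltonian n (torusGraph d L) J Δ with hH₀
  set O := stagSpin n σ α with hO
  have hH₀herm : H₀.IsHermitian := xxzHamiltonian_isHermitian n _ J Δ
  have hOherm : O.IsHermitian := isHermitian_stagSpin n σ α
  obtain ⟨U, hUU, hUHconj, hUOconj⟩ := exists_halfTurn_flip n (torusGraph d L) J Δ σ α
  have hUH : U * H₀ = H₀ * U := mul_eq_mul_of_conj_eq hUU hUHconj
  have hUO : U * O = -(O * U) := mul_eq_neg_mul_of_conj_eq_neg hUU hUOconj
  have hUOO : U * (O * O) = O * O * U := by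
    rw [← Matrix.mul_assoc, hUO, Matrix.neg_mul, Matrix.mul_assoc, hUO, Matrix.mul_neg, neg_neg, Matrix.mul_assoc]
  have hOOherm : (O * O).IsHermitian := by
    have h := Matrix.isHermitian_mul_conjTranspose_self O
    rwa [hOherm.eq] at h
  -- the symmetric long-range-ordered ground eigenstate and its moments
  obtain ⟨Φ, hΦ, hHΦ, ⟨c, hUΦ⟩, hlroΦ⟩ :=
    Matrix.exists_groundState_eigenvector_of_symmetry_re_ge hH₀herm hUH hOOherm hUOO
  have hO1 : star Φ ⬝ᵥ (O *ᵥ Φ) = 0 := dotProduct_mulVec_eq_zero_of_anticommute hUU hUO hΦ hUΦ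
  have hO3 : star Φ ⬝ᵥ ((O * O * O) *ᵥ Φ) = 0 :=
    dotProduct_mulVec_eq_zero_of_anticommute hUU (mul_cube_eq_neg_of_anticommute hUO) hΦ hUΦ
  have hlro2 : (μ * sNorm n * (Fintype.card (TorusSite d L) : ℝ)) ^ 2 ≤ (star Φ ⬝ᵥ (O *ᵥ (O *ᵥ Φ))).re := by
    rw [hμs, Matrix.mulVec_mulVec, mul_pow]
    exact hlro.trans hlroΦ
  have hμ1 : μ ≤ 1 :=
    mu_le_one_of_sq_le (mul_pos hsN (Nat.cast_pos.mpr Fintype.card_pos)) hlro2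
      (re_dotProduct_stagSpin_sq_mulVec_le n σ α hΦ)
  -- KT93 §2 data as operators on `ℓ²(Λ)`
  set hx : TorusSite d L → SpinSpace (TorusSite d L) (n + 1) →L[ℂ] SpinSpace (TorusSite d L) (n + 1) :=
    fun x => toEuclideanCLM (n := TensorIndex (TorusSite d L) (n + 1)) (𝕜 := ℂ)
      (localHam n (torusGraph d L) J Δ x) with hhx_def
  set ox : TorusSite d L → SpinSpace (TorusSite d L) (n + 1) →L[ℂ] SpinSpace (TorusSite d L) (n + 1) :=
    fun x => toEuclideanCLM (n := TensorIndex (TorusSite d L) (n + 1)) (𝕜 := ℂ)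
      ((stagSign σ x : ℂ) • siteSpin n x α) with hox_def
  have hsumh : (∑ x, hx x) = toEuclideanCLM (n := TensorIndex (TorusSite d L) (n + 1)) (𝕜 := ℂ) H₀ := by
    simp only [hhx_def]
    rw [← map_sum, sum_localHam]
  have hsumo : (∑ x, ox x) = toEuclideanCLM (n := TensorIndex (TorusSite d L) (n + 1)) (𝕜 := ℂ) O := by
    simp only [hox_def]
    rw [← map_sum]
    rfl
  have hsym_h : ∀ x, (hx x : SpinSpace (TorusSite d L) (n + 1) →ₗ[ℂ] SpinSpace (TorusSite d L) (n + 1)).IsSymmetric :=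
    fun x => isSymmetric_toEuclideanCLM_of_isHermitian (isHermitian_localHam n _ J Δ x)
  have hsym_o : ∀ x, (ox x : SpinSpace (TorusSite d L) (n + 1) →ₗ[ℂ] SpinSpace (TorusSite d L) (n + 1)).IsSymmetric :=
    fun x => isSymmetric_toEuclideanCLM_of_isHermitian (isHermitian_stagSign_smul_siteSpin n σ x α)
  have hhb : ∀ x, ‖hx x‖ ≤ hbar d n J Δ := fun x => by
    simp only [hhx_def]
    rw [Matrix.l2_opNorm_toEuclideanCLM]
    exact norm_localHam_le d L n J Δ x
  have hob : ∀ x, ‖ox x‖ ≤ sNorm n := fun x => by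
    simp only [hox_def]
    rw [Matrix.l2_opNorm_toEuclideanCLM]
    exact norm_stagSign_smul_siteSpin_le n σ x α
  have hoo : ∀ x y, Commute (ox x) (ox y) := fun x y => by
    by_cases hxy : x = y
    · subst hxy
      exact Commute.refl _
    · exact commute_toEuclideanCLM_of_commute (commute_stagSign_smul_siteSpin n σ hxy α α)
  have hho : ∀ x y, y ∉ nbhd d L x → Commute (hx x) (ox y) := fun x y hy => by
    obtain ⟨hne, hadj⟩ := ne_and_not_adj_of_not_mem_nbhd d L hy
    exact commute_toEuclideanCLM_of_commute
      (commute_localHam_stagSign_smul_siteSpin n σ (torusGraph d L) J Δ hne hadj α)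
  have hsupp : ∀ x, (nbhd d L x).card ≤ 2 * d + 2 := fun x => (card_nbhd_le d L x).trans (by omega)
  -- the symmetric ground state and its hypotheses
  have hΦ1 : ‖(toLp 2 Φ : SpinSpace (TorusSite d L) (n + 1))‖ = 1 := norm_toLp_eq_one_of_dotProduct hΦ
  have hHΦ' : (∑ x, hx x) (toLp 2 Φ) = (H₀.groundEnergy : ℂ) • toLp 2 Φ := by
    rw [hsumh, toEuclideanCLM_toLp, hHΦ, toLp_smul]
  have hground : ∀ ψ : SpinSpace (TorusSite d L) (n + 1), ‖ψ‖ = 1 →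
      H₀.groundEnergy ≤ (⟪ψ, (∑ x, hx x) ψ⟫_ℂ).re := fun ψ hψ => by
    rw [hsumh]
    exact Matrix.groundEnergy_le_re_inner_toEuclideanCLM' hH₀herm ψ hψ
  have hOΦ1 : ⟪(toLp 2 Φ : SpinSpace (TorusSite d L) (n + 1)), (∑ x, ox x) (toLp 2 Φ)⟫_ℂ = 0 := by
    rw [hsumo, toEuclideanCLM_toLp, inner_toLp_toLp_eq_dotProduct, hO1]
  have hlro3 : (μ * sNorm n * Fintype.card (TorusSite d L)) ^ 2 ≤
      (⟪(toLp 2 Φ : SpinSpace (TorusSite d L) (n + 1)), (∑ x, ox x) ((∑ x, ox x) (toLp 2 Φ))⟫_ℂ).re := by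
    rw [hsumo, toEuclideanCLM_toLp, toEuclideanCLM_toLp, inner_toLp_toLp_eq_dotProduct]
    exact hlro2
  have hOΦ3 : ⟪(toLp 2 Φ : SpinSpace (TorusSite d L) (n + 1)),
      (∑ x, ox x) ((∑ x, ox x) ((∑ x, ox x) (toLp 2 Φ)))⟫_ℂ = 0 := by
    rw [hsumo, toEuclideanCLM_toLp, toEuclideanCLM_toLp, toEuclideanCLM_toLp, inner_toLp_toLp_eq_dotProduct,
      Matrix.mulVec_mulVec, Matrix.mulVec_mulVec, hO3]
  -- the sourced ground state
  set HB := H₀ - (B : ℂ) • O with hHB_def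
  have hHBherm : HB.IsHermitian :=
    hH₀herm.sub (hOherm.smul (by rw [isSelfAdjoint_iff, Complex.star_def, Complex.conj_ofReal]))
  have hfield : (∑ x, hx x) - (B : ℂ) • (∑ x, ox x) =
      toEuclideanCLM (n := TensorIndex (TorusSite d L) (n + 1)) (𝕜 := ℂ) HB := by
    rw [hsumh, hsumo, ← map_smul, ← map_sub]
  have hΦB1 : ‖(toLp 2 ΦB : SpinSpace (TorusSite d L) (n + 1))‖ = 1 := norm_toLp_eq_one_of_dotProduct hΦB
  have hmin : ∀ ψ : SpinSpace (TorusSite d L) (n + 1), ‖ψ‖ = 1 →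
      (⟪(toLp 2 ΦB : SpinSpace (TorusSite d L) (n + 1)),
          ((∑ x, hx x) - (B : ℂ) • (∑ x, ox x)) (toLp 2 ΦB)⟫_ℂ).re ≤
        (⟪ψ, ((∑ x, hx x) - (B : ℂ) • (∑ x, ox x)) ψ⟫_ℂ).re := fun ψ hψ => by
    rw [hfield]
    exact Matrix.re_inner_toEuclideanCLM_le_of_groundState hHBherm hΦB hHB ψ hψ
  -- KT93 (7.10)
  have h := KomaTasaki.kaplanHorschVonDerLinden_order_density hx ox (nbhd d L) (2 * d + 2) (hbar d n J Δ) (sNorm n) μ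
    (toLp 2 Φ) H₀.groundEnergy hsym_h hsym_o hhb hob hsN hoo hho hsupp hΦ1 hHΦ' hground hOΦ1 hμ hμ1 hlro3 hOΦ3 hB
    hΦB1 hmin
  rw [hμs, hsumo, toEuclideanCLM_toLp, inner_toLp_toLp_eq_dotProduct] at h
  exact h

/-- **The same floor for the uniform mixture of the ground states of `H - B·O`** (tracial sourced ground state):
`N⁻¹ Re ω_{GS,B}(O) ≥ s - (2d+2)² h̄ / (μ² B N²)`. [cite: KomaTasaki1993, Theorem 7.1 (7.10), (7.5)] -/
theorem xxz_ground_sourcedOrder_ge_finiteVolume_groundStateFunctional (L : ℕ) [NeZero L] (n : ℕ) (J Δ : ℝ)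
    (σ : TorusSite d L → ℕ) (α : Fin 3) {s : ℝ} (hs : 0 < s)
    (hlro : s ^ 2 * (Fintype.card (TorusSite d L) : ℝ) ^ 2 ≤
      ((xxzHamiltonian n (torusGraph d L) J Δ).groundStateFunctional (stagSpin n σ α * stagSpin n σ α)).re)
    {B : ℝ} (hB : 0 < B) :
    s - ((2 * d + 2 : ℕ) : ℝ) ^ 2 * hbar d n J Δ / (s / sNorm n) ^ 2 /
        (B * (Fintype.card (TorusSite d L) : ℝ) ^ 2) ≤
      ((xxzHamiltonian n (torusGraph d L) J Δ - (B : ℂ) • stagSpin n σ α).groundStateFunctional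
          (stagSpin n σ α)).re / (Fintype.card (TorusSite d L) : ℝ) := by
  have hHB : (xxzHamiltonian n (torusGraph d L) J Δ - (B : ℂ) • stagSpin n σ α).IsHermitian :=
    (xxzHamiltonian_isHermitian n _ J Δ).sub ((isHermitian_stagSpin n σ α).smul
      (by rw [isSelfAdjoint_iff, Complex.star_def, Complex.conj_ofReal]))
  exact le_re_groundStateFunctional_div_of_forall_groundState hHB _ (Nat.cast_nonneg _)
    fun ΦB hΦB hK => xxz_ground_sourcedOrder_ge_finiteVolume L n J Δ σ α hs hlro hB hΦB hK

/-- **The error term is explicit and `O(1/(BN²))`**: written out, the floor is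
`s - (2d+2)²·((|J|/2)·2d·(2+|Δ|)ō²)·ō²/(s²BN²)`, `ō = n/2+1`; at fixed `B > 0` it tends to `s` as `N → ∞`, and at fixed
`N` it is vacuous for `B ≲ (2d+2)²h̄ō²/(s³N²)` (Tasaki's continuity remark: the order of limits matters).
[cite: KomaTasaki1993, (7.10)] [cite: Tasaki2019Tower, Theorem 2.1 and the remark after it] -/
theorem finiteVolume_errorTerm_eq (d n : ℕ) (J Δ s B N : ℝ) :
    ((2 * d + 2 : ℕ) : ℝ) ^ 2 * hbar d n J Δ / (s / sNorm n) ^ 2 / (B * N ^ 2) =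
      ((2 * d + 2 : ℕ) : ℝ) ^ 2 * (|J| / 2 * ((2 * d : ℕ) * ((2 + |Δ|) * sNorm n ^ 2))) * sNorm n ^ 2 /
        (s ^ 2 * (B * N ^ 2)) := by
  rw [hbar, div_pow, div_div_eq_mul_div, div_div]

end FiniteVolume

/-! ### The finite-volume `U(1)` (factor `√2`) and `SU(2)` (factor `√3`) tower bounds: KT93 Theorem 7.3 (7.24)–(7.26) -/

section FiniteVolumeTower

variable {d : ℕ}

/-- **KT93 THEOREM 7.3 (`U(1)`, factor `√2`) IN ONE FINITE VOLUME, FOR THE XXZ MODEL — explicit constants, no limit.**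
On the torus `Λ = (ℤ/Lℤ)^d` (`N` sites), `H = xxzHamiltonian n (torusGraph d L) J Δ` (any `J`, `Δ`),
`O^{(1)} = Σ_x(-1)^{σx}Sˣ_x`.  INPUT: `s > 0` with `s²N² ≤ Re ω_GS((O^{(1)})²)`.  Put `μ = s/ō`, `ō = n/2+1`,
`h̄ = hbar d n J Δ`, `r = 2d+2`.  Then for every `k ≥ 1` satisfying the size condition `k² 2^k ≤ μ^{2k} N` (so that
the tower trial state `Ξ^{(k)}` (7.23) on a symmetric long-range-ordered ground state `Φ` in an `Sᶻ_tot`-sector is well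
defined), every `B > 0` and EVERY normalised ground state `Φ_B` of `H - B·O^{(1)}`, there is a number `x`
(`= Re⟨Ξ^{(k)}, O^{(1)}Ξ^{(k)}⟩`) with
(a) `Re⟨Φ_B, O^{(1)}Φ_B⟩ ≥ x - k2^{k+1}h̄rμ^{-k}/B` ((7.5) + (7.24)); (b) `x ≥ 0`;
(c) `((2k+1)/(2k)·x)^{2k} ≥ (2(sN)²)^k - k²ō(2ōN)^{2k-1}` ((7.25)–(7.26)) — i.e.
`N⁻¹Re⟨Φ_B,O^{(1)}Φ_B⟩ ≥ (2k/(2k+1))((2s²)^k - k²2^{2k-1}ō^{2k}N⁻¹)₊^{1/(2k)} - k2^{k+1}h̄rμ^{-k}/(BN)`, which is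
`√2 s - ε` for `k`, then `N`, large (`xxzAF_ground_spontaneousStaggeredMagnetisation`).  Tree theorems used by name:
`KomaTasaki.U1System.field_order_ge_xiState_of_card_ge`, `KomaTasaki.U1System.theorem_2_5_orderOne_fin` over `u1System`.
[cite: KomaTasaki1993, Theorem 7.3, proof (7.5), (7.23)–(7.26)] [cite: KomaTasaki1994, Theorem 2.5 (2.30)] -/
theorem xxz_ground_sourcedOrder_ge_finiteVolume_u1 (L : ℕ) [NeZero L] (n : ℕ) (J Δ : ℝ) (σ : TorusSite d L → ℕ)
    {s : ℝ} (hs : 0 < s)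
    (hlro : s ^ 2 * (Fintype.card (TorusSite d L) : ℝ) ^ 2 ≤
      ((xxzHamiltonian n (torusGraph d L) J Δ).groundStateFunctional (stagSpin n σ 0 * stagSpin n σ 0)).re)
    {k : ℕ} (hk : 1 ≤ k) (hN : (k : ℝ) ^ 2 * 2 ^ k ≤ (s / sNorm n) ^ (2 * k) * (Fintype.card (TorusSite d L) : ℝ))
    {B : ℝ} (hB : 0 < B) {ΦB : TensorIndex (TorusSite d L) (n + 1) → ℂ} (hΦB : star ΦB ⬝ᵥ ΦB = 1)
    (hHB : (xxzHamiltonian n (torusGraph d L) J Δ - (B : ℂ) • stagSpin n σ 0) *ᵥ ΦB =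
      ((xxzHamiltonian n (torusGraph d L) J Δ - (B : ℂ) • stagSpin n σ 0).groundEnergy : ℂ) • ΦB) :
    ∃ x : ℝ, 0 ≤ x ∧
      (2 * (s * (Fintype.card (TorusSite d L) : ℝ)) ^ 2) ^ k -
          (k : ℝ) ^ 2 * sNorm n * (2 * sNorm n * (Fintype.card (TorusSite d L) : ℝ)) ^ (2 * k - 1) ≤
        ((2 * k + 1) / (2 * k) * x) ^ (2 * k) ∧
      x - ((k : ℝ) * 2 ^ (k + 1) * hbar d n J Δ * ((2 * d + 2 : ℕ) : ℝ) / (s / sNorm n) ^ k) / B ≤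
        (star ΦB ⬝ᵥ (stagSpin n σ 0 *ᵥ ΦB)).re := by
  set μ : ℝ := s / sNorm n with hμ_def
  have hsN : 0 < sNorm n := lt_of_lt_of_le zero_lt_one (one_le_sNorm n)
  have hμ : 0 < μ := div_pos hs hsN
  have hμs : μ * sNorm n = s := by rw [hμ_def, div_mul_cancel₀ _ hsN.ne']
  -- the long-range-ordered ground eigenstate in an `Sᶻ_tot`-sector, and hypothesis iv)
  set H₀ := xxzHamiltonian n (torusGraph d L) J Δ with hH₀
  have hH₀herm : H₀.IsHermitian := xxzHamiltonian_isHermitian n _ J Δ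
  obtain ⟨Φ, hΦ, hHΦ, ⟨ν, hNΦ⟩, hlroΦ⟩ := Matrix.exists_groundState_eigenvector_re_ge hH₀herm
    (totalSpin_isHermitian n 2) (HardCoreBoson.commute_xxzHamiltonian_totalSpin_two n _ J Δ).eq
    (stagSpin n σ 0 * stagSpin n σ 0)
  have hlro' : (μ * sNorm n * (Fintype.card (TorusSite d L) : ℝ)) ^ 2 ≤
      (star Φ ⬝ᵥ (stagSpin n σ 0 *ᵥ (stagSpin n σ 0 *ᵥ Φ))).re := by
    rw [hμs, Matrix.mulVec_mulVec, mul_pow]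
    exact hlro.trans hlroΦ
  have hLRO : KomaTasaki.IsLROEigenstate (u1System d L n J Δ σ) (toLp 2 Φ) H₀.groundEnergy μ :=
    u1System_isLROEigenstate d L n J Δ σ hΦ hHΦ hNΦ hμ hlro'
  -- the ground-state hypotheses
  have hground : ∀ ψ : SpinSpace (TorusSite d L) (n + 1), ‖ψ‖ = 1 →
      H₀.groundEnergy ≤ (⟪ψ, (u1System d L n J Δ σ).hamiltonian ψ⟫_ℂ).re := by
    intro ψ hψ
    rw [u1System_hamiltonian]
    exact Matrix.groundEnergy_le_re_inner_toEuclideanCLM' hH₀herm ψ hψ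
  set HB := H₀ - (B : ℂ) • stagSpin n σ 0 with hHB_def
  have hHBherm : HB.IsHermitian :=
    hH₀herm.sub ((isHermitian_stagSpin n σ 0).smul (by rw [isSelfAdjoint_iff, Complex.star_def, Complex.conj_ofReal]))
  have hfield : (u1System d L n J Δ σ).hamiltonian - (B : ℂ) • (u1System d L n J Δ σ).order 0 =
      toEuclideanCLM (n := TensorIndex (TorusSite d L) (n + 1)) (𝕜 := ℂ) HB := by
    rw [u1System_field]
  have hΦB1 : ‖(toLp 2 ΦB : SpinSpace (TorusSite d L) (n + 1))‖ = 1 := norm_toLp_eq_one_of_dotProduct hΦB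
  have hmin : ∀ ψ : SpinSpace (TorusSite d L) (n + 1), ‖ψ‖ = 1 →
      (⟪(toLp 2 ΦB : SpinSpace (TorusSite d L) (n + 1)),
          ((u1System d L n J Δ σ).hamiltonian - (B : ℂ) • (u1System d L n J Δ σ).order 0) (toLp 2 ΦB)⟫_ℂ).re ≤
        (⟪ψ, ((u1System d L n J Δ σ).hamiltonian - (B : ℂ) • (u1System d L n J Δ σ).order 0) ψ⟫_ℂ).re := by
    intro ψ hψ
    rw [hfield]
    exact Matrix.re_inner_toEuclideanCLM_le_of_groundState hHBherm hΦB hHB ψ hψ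
  -- KT93 Theorem 7.3: (7.5) + (7.24), and (7.25)–(7.26)
  have h1 := (u1System d L n J Δ σ).field_order_ge_xiState_of_card_ge hLRO hground hk hN hB hΦB1 hmin
  obtain ⟨hx0, hfin⟩ := (u1System d L n J Δ σ).theorem_2_5_orderOne_fin hLRO k hk
  refine ⟨(⟪(u1System d L n J Δ σ).xiState k (toLp 2 Φ),
      (u1System d L n J Δ σ).order 0 ((u1System d L n J Δ σ).xiState k (toLp 2 Φ))⟫_ℂ).re, hx0, ?_, ?_⟩
  · rw [u1System_obar, hμs] at hfin
    exact hfin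
  · have eB : (⟪(toLp 2 ΦB : SpinSpace (TorusSite d L) (n + 1)), (u1System d L n J Δ σ).order 0 (toLp 2 ΦB)⟫_ℂ).re =
        (star ΦB ⬝ᵥ (stagSpin n σ 0 *ᵥ ΦB)).re := by
      rw [u1System_order_zero, toEuclideanCLM_toLp, inner_toLp_toLp_eq_dotProduct]
    rw [eB, u1System_hbar, u1System_r] at h1
    exact h1

/-- **KT93 COROLLARY 7.2 / THEOREM 6.1 (`SU(2)`, factor `√3`) IN ONE FINITE VOLUME, FOR THE HEISENBERG ANTIFERROMAGNET —
explicit constants, no limit.**  On the EVEN torus `Λ = (ℤ/Lℤ)^d`, `2 ∣ L`, `d ≥ 1`, for the isotropic antiferromagnet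
`H = xxzHamiltonian n (torusGraph d L) J 1 = JΣ𝐒_x·𝐒_y`, `J > 0`, and `O^{(1)} = Σ_x(-1)^{σx}Sˣ_x`.  INPUT: `s > 0`
with `s²N² ≤ Re ω_GS((O^{(1)})²)`.  With `μ = s/ō`, `ō = n/2+1`, `h̄ = hbar d n J 1`, `r = 2d+2`: for every `k ≥ 1` with
`k² 2^k ≤ μ^{2k} N`, every `B > 0` and EVERY normalised ground state `Φ_B` of `H - B·O^{(1)}` there is `x`
(`= Re⟨Ξ^{(k)}, O^{(1)}Ξ^{(k)}⟩` on a symmetric long-range-ordered ground state, an `SU(2)` singlet by Lieb–Mattis,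
`totalSpin_mulVec_eq_zero_of_heisenberg_groundState` — KT93 i'')) with
(a) `Re⟨Φ_B, O^{(1)}Φ_B⟩ ≥ x - k2^{k+1}h̄rμ^{-k}/B`; (b) `x ≥ 0`;
(c) `((2k+1)/(2k)·x)^{2k} ≥ (3(sN)²)^k/(2k+1) - (8k²3^k + 8k³4^k + k²4^k)ō^{2k}N^{2k-1}` — i.e.
`N⁻¹Re⟨Φ_B,O^{(1)}Φ_B⟩ ≥ (2k/(2k+1))(2k+1)^{-1/(2k)}√3 s(1 - O_k(N⁻¹))^{1/(2k)} - O_k((BN)⁻¹)`, which is `√3 s - ε` for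
`k`, then `N`, large (`heisenbergAF_ground_spontaneousStaggeredMagnetisation`).  Tree theorem used by name:
`KomaTasaki.SU2Datum.field_order_ge_of_card_ge` over `su2Datum`.
[cite: KomaTasaki1993, Corollary 7.2, proof p. 211; Theorem 7.3 (7.5), (7.23)–(7.26); Theorem 6.1]
[cite: KomaTasaki1994, Theorem 2.5 (2.30) and the remark following it] [cite: LiebMattis1962, Theorem] -/
theorem heisenbergAF_ground_sourcedOrder_ge_finiteVolume_su2 (hd : 1 ≤ d) (L : ℕ) [NeZero L] (hL : 2 ∣ L) (n : ℕ)
    {J : ℝ} (hJ : 0 < J) (σ : TorusSite d L → ℕ) {s : ℝ} (hs : 0 < s)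
    (hlro : s ^ 2 * (Fintype.card (TorusSite d L) : ℝ) ^ 2 ≤
      ((xxzHamiltonian n (torusGraph d L) J 1).groundStateFunctional (stagSpin n σ 0 * stagSpin n σ 0)).re)
    {k : ℕ} (hk : 1 ≤ k) (hN : (k : ℝ) ^ 2 * 2 ^ k ≤ (s / sNorm n) ^ (2 * k) * (Fintype.card (TorusSite d L) : ℝ))
    {B : ℝ} (hB : 0 < B) {ΦB : TensorIndex (TorusSite d L) (n + 1) → ℂ} (hΦB : star ΦB ⬝ᵥ ΦB = 1)
    (hHB : (xxzHamiltonian n (torusGraph d L) J 1 - (B : ℂ) • stagSpin n σ 0) *ᵥ ΦB =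
      ((xxzHamiltonian n (torusGraph d L) J 1 - (B : ℂ) • stagSpin n σ 0).groundEnergy : ℂ) • ΦB) :
    ∃ x : ℝ, 0 ≤ x ∧
      (3 * (s * (Fintype.card (TorusSite d L) : ℝ)) ^ 2) ^ k / (2 * k + 1) -
          (8 * (k : ℝ) ^ 2 * 3 ^ k + 8 * (k : ℝ) ^ 3 * 4 ^ k + (k : ℝ) ^ 2 * 4 ^ k) *
            sNorm n ^ (2 * k) * (Fintype.card (TorusSite d L) : ℝ) ^ (2 * k - 1) ≤
        ((2 * k + 1) / (2 * k) * x) ^ (2 * k) ∧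
      x - ((k : ℝ) * 2 ^ (k + 1) * hbar d n J 1 * ((2 * d + 2 : ℕ) : ℝ) / (s / sNorm n) ^ k) / B ≤
        (star ΦB ⬝ᵥ (stagSpin n σ 0 *ᵥ ΦB)).re := by
  set μ : ℝ := s / sNorm n with hμ_def
  have hsN : 0 < sNorm n := lt_of_lt_of_le zero_lt_one (one_le_sNorm n)
  have hμ : 0 < μ := div_pos hs hsN
  have hμs : μ * sNorm n = s := by rw [hμ_def, div_mul_cancel₀ _ hsN.ne']
  set H₀ := xxzHamiltonian n (torusGraph d L) J 1 with hH₀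
  have hH₀herm : H₀.IsHermitian := xxzHamiltonian_isHermitian n _ J 1
  obtain ⟨Φ, hΦ, hHΦ, ⟨ν, hNΦ⟩, hlroΦ⟩ := Matrix.exists_groundState_eigenvector_re_ge hH₀herm
    (totalSpin_isHermitian n 2) (HardCoreBoson.commute_xxzHamiltonian_totalSpin_two n _ J 1).eq
    (stagSpin n σ 0 * stagSpin n σ 0)
  have hlro' : (μ * sNorm n * (Fintype.card (TorusSite d L) : ℝ)) ^ 2 ≤
      (star Φ ⬝ᵥ (stagSpin n σ 0 *ᵥ (stagSpin n σ 0 *ᵥ Φ))).re := by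
    rw [hμs, Matrix.mulVec_mulVec, mul_pow]
    exact hlro.trans hlroΦ
  have hLRO : KomaTasaki.IsLROEigenstate (u1System d L n J 1 σ) (toLp 2 Φ) H₀.groundEnergy μ :=
    u1System_isLROEigenstate d L n J 1 σ hΦ hHΦ hNΦ hμ hlro'
  -- i''): the symmetric ground state is an `SU(2)` singlet (Lieb–Mattis)
  have hJΦ : ∀ a, (su2Datum d L n J 1 σ).J a (toLp 2 Φ) = 0 :=
    su2Datum_J_apply_eq_zero d L n J 1 σ
      (totalSpin_mulVec_eq_zero_of_heisenberg_groundState hd L hL n hJ hHΦ 0)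
      (totalSpin_mulVec_eq_zero_of_heisenberg_groundState hd L hL n hJ hHΦ 1)
  have hground : ∀ ψ : SpinSpace (TorusSite d L) (n + 1), ‖ψ‖ = 1 →
      H₀.groundEnergy ≤ (⟪ψ, (u1System d L n J 1 σ).hamiltonian ψ⟫_ℂ).re := by
    intro ψ hψ
    rw [u1System_hamiltonian]
    exact Matrix.groundEnergy_le_re_inner_toEuclideanCLM' hH₀herm ψ hψ
  set HB := H₀ - (B : ℂ) • stagSpin n σ 0 with hHB_def
  have hHBherm : HB.IsHermitian :=
    hH₀herm.sub ((isHermitian_stagSpin n σ 0).smul (by rw [isSelfAdjoint_iff, Complex.star_def, Complex.conj_ofReal]))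
  have hfield : (u1System d L n J 1 σ).hamiltonian - (B : ℂ) • (u1System d L n J 1 σ).order 0 =
      toEuclideanCLM (n := TensorIndex (TorusSite d L) (n + 1)) (𝕜 := ℂ) HB := by
    rw [u1System_field]
  have hΦB1 : ‖(toLp 2 ΦB : SpinSpace (TorusSite d L) (n + 1))‖ = 1 := norm_toLp_eq_one_of_dotProduct hΦB
  have hmin : ∀ ψ : SpinSpace (TorusSite d L) (n + 1), ‖ψ‖ = 1 →
      (⟪(toLp 2 ΦB : SpinSpace (TorusSite d L) (n + 1)),
          ((u1System d L n J 1 σ).hamiltonian - (B : ℂ) • (u1System d L n J 1 σ).order 0) (toLp 2 ΦB)⟫_ℂ).re ≤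
        (⟪ψ, ((u1System d L n J 1 σ).hamiltonian - (B : ℂ) • (u1System d L n J 1 σ).order 0) ψ⟫_ℂ).re := by
    intro ψ hψ
    rw [hfield]
    exact Matrix.re_inner_toEuclideanCLM_le_of_groundState hHBherm hΦB hHB ψ hψ
  -- KT93 Corollary 7.2 in finite volume: Theorem 7.3 ((7.5) + (7.24)) and Theorem 6.1 ((7.25)–(7.26))
  obtain ⟨h1, hx0, hfin⟩ := (su2Datum d L n J 1 σ).field_order_ge_of_card_ge hLRO hJΦ hground hk hN hB hΦB1 hmin
  refine ⟨(⟪(u1System d L n J 1 σ).xiState k (toLp 2 Φ),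
      (u1System d L n J 1 σ).order 0 ((u1System d L n J 1 σ).xiState k (toLp 2 Φ))⟫_ℂ).re, hx0, ?_, ?_⟩
  · rw [u1System_obar, hμs] at hfin
    exact hfin
  · have eB : (⟪(toLp 2 ΦB : SpinSpace (TorusSite d L) (n + 1)), (u1System d L n J 1 σ).order 0 (toLp 2 ΦB)⟫_ℂ).re =
        (star ΦB ⬝ᵥ (stagSpin n σ 0 *ᵥ ΦB)).re := by
      rw [u1System_order_zero, toEuclideanCLM_toLp, inner_toLp_toLp_eq_dotProduct]
    rw [eB, u1System_hbar, u1System_r] at h1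
    exact h1

end FiniteVolumeTower

end XXZKT

end Literature.MathematicalPhysics.QuantumLattice
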